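import Literature.AlgebraicGeometry.Motives.ClosedGraphMorphism
import Literature.AlgebraicGeometry.Motives.AlgPointsSeparate
import HarnessLib

/-!
# A closed graph over a normal variety is the graph of a UNIQUE morphism (characteristic zero)

Layer `Literature/AlgebraicGeometry/Motives`, namespace `Literature.AlgebraicGeometry.Motives`.  KERNEL ONLY: theorems.
The `∃!` packaging of ★ `exists_hom_forall_comp_eq_of_isClosed` (`Motives/ClosedGraphMorphism`: existence of
`ψ : T → P` with `x ≫ ψ = φ₀ x` for a closed graph `Γ` over an integral normal `T`, `P` proper, char `0`) with ★
`SchemeOver.hom_ext_of_forall_algPoints` (`Motives/AlgPointsSeparate`: `K`-points separate morphisms from a reduced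
`K`-scheme locally of finite type to a separated one) — the form the seesaw/graph construction of classifying maps
consumes (cell `hodgecm-mathlib`, J0b road (i) steps S5 + S7 of CENSUS-R3a). [Mumford AV §4; §10 p. 89.]

## References
* [MumfordAV1970] D. Mumford, *Abelian Varieties* (1970), §4 (morphisms determined by points) and §10 (p. 89).
-/

noncomputable section

universe u

open CategoryTheory CategoryTheory.Limits AlgebraicGeometry MonoidalCategory CartesianMonoidalCategory

namespace Literature.AlgebraicGeometry.Motives

variable {K : Type u} [Field K] [IsAlgClosed K] {T P : SchemeOver K}
  [IsIntegral T.left] [LocallyOfFiniteType T.hom] [IsProper P.hom]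

/-- **Uniqueness of the morphism with prescribed values on `K`-points** (`T` reduced of finite type, `P` separated over
`K = K̄`): two morphisms `ψ₁ ψ₂ : T → P` with `x ≫ ψ₁ = φ₀ x = x ≫ ψ₂` for all `K`-points coincide.
[cite: MumfordAV1970, §4 (morphisms of varieties are determined by their effect on points)] -/
theorem hom_eq_of_forall_comp_eq (φ₀ : AlgPoints T K → AlgPoints P K) {ψ₁ ψ₂ : T ⟶ P}
    (h₁ : ∀ x : AlgPoints T K, x ≫ ψ₁ = φ₀ x) (h₂ : ∀ x : AlgPoints T K, x ≫ ψ₂ = φ₀ x) : ψ₁ = ψ₂ :=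
  haveI : IsSeparated P.hom := inferInstance
  SchemeOver.hom_ext_of_forall_algPoints K fun x => (h₁ x).trans (h₂ x).symm

/-- **A closed graph over a normal variety is the graph of a UNIQUE morphism** (characteristic zero): for `T` integral
normal locally of finite type over `K = K̄` of characteristic `0`, `P` proper, `φ₀ : T(K) → P(K)` and a closed
`Γ ⊆ T ×_K P` whose `K`-points are exactly the pairs `(x, φ₀ x)`, there is exactly one `ψ : T → P` with `x ≫ ψ = φ₀ x`
for all `K`-points `x` (existence ★ `exists_hom_forall_comp_eq_of_isClosed` — Zariski's Main Theorem road; uniqueness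
because `K`-points separate morphisms to a separated scheme). [cite: MumfordAV1970, §4 and §10 (p. 89)] -/
theorem existsUnique_hom_forall_comp_eq_of_isClosed [CharZero K]
    (hTn : ∀ t : T.left, IsIntegrallyClosed (T.left.presheaf.stalk t))
    (Γ : Set ↥(T ⊗ P).left) (hΓ : IsClosed Γ) (φ₀ : AlgPoints T K → AlgPoints P K)
    (hΓφ : ∀ (x : AlgPoints T K) (y : AlgPoints P K),
      AlgPoints.pt (lift x y : AlgPoints (T ⊗ P) K) ∈ Γ ↔ y = φ₀ x) :
    ∃! ψ : T ⟶ P, ∀ x : AlgPoints T K, x ≫ ψ = φ₀ x := by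
  obtain ⟨ψ, hψ⟩ := exists_hom_forall_comp_eq_of_isClosed hTn Γ hΓ φ₀ hΓφ
  exact ⟨ψ, hψ, fun ψ' hψ' => hom_eq_of_forall_comp_eq φ₀ hψ' hψ⟩

end Literature.AlgebraicGeometry.Motives

end
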